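import Mathlib
import Literature.AlgebraicGeometry.Resolution.CobordantGame
import Literature.AlgebraicGeometry.Resolution.FormalCoordinateChange
import Summits.ResolutionOfSingularities.ResolutionOfSingularities.Theorems.WeightedInvariantGlobalizeLocalDropCanonize
import Summits.ResolutionOfSingularities.ResolutionOfSingularities.Theorems.WeightedInvariantGlobalizeLocalDropCylinder
import Summits.ResolutionOfSingularities.ResolutionOfSingularities.Theorems.WeightedInvariantLocalWeightedDropTschirnhausFormAux
import Summits.ResolutionOfSingularities.ResolutionOfSingularities.Theorems.WeightedInvariantLocalWeightedDropPlaneMonomialPhaseAux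
import Summits.ResolutionOfSingularities.ResolutionOfSingularities.Theorems.WeightedInvariantLocalWeightedDropTerminalDoublePointsAux
import Summits.ResolutionOfSingularities.ResolutionOfSingularities.Theorems.WeightedInvariantLocalWeightedDropInsepPointStep
import Summits.ResolutionOfSingularities.ResolutionOfSingularities.Theorems.WeightedInvariantLocalWeightedDropInsepLift

/-!
# `WeightedInvariant.LocalWeightedDrop`, line `hasse-ridge-face-selection`: FORMAL CHANGES OF THE OLD VARIABLES are free
# moves for `y^d + A₀(x₀,x₁)`, and the INSEP lift with such changes (DECISION (D4) of CHAIN v3)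

Crux item stmt-ResolutionOfSingularities-8899 `LocalWeightedDrop` (route `ResolutionOfSingularities/WeightedInvariant`),
serving the door `WeightedConstruction` stmt-ResolutionOfSingularities-0571.  [OURS · L1 W4.3, chain w43, stub worker 3
(gen 2): complement to the (u3) interface `insepWon_of_rank` (p481657) required by DECISION (D4) of CHAIN v3 («terminal /
monomial exits are read in SOME formal coordinates of `k[[x₁,x₂]]` — Hauser–Wagner's subordinate changes are non-linear — and
transported by `won_subst_iff`»); NOT a statement of any manuscript.]

* `InsepDoublePoint.won_Xpow_add_xChange_iff` (every `d`, every field): for a formal coordinate change `θ` of `k[[x₀,x₁]]`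
  (`θ(0) = 0`, invertible linear part), `y^d + A₀(θ)` is won iff `y^d + A₀` is won — the change `Θ = (θ, y)` of all three
  variables is legal (`won_subst_iff`) and `Θ^*(y^d + A₀♮) = y^d + (θ^* A₀)♮` (`subst_rename_eq` / `rename_subst_eq`);
* `insepWon_of_rankX` (characteristic `2`, `k` algebraically closed): the INSEP lift of `…InsepLift` with a FOURTH move
  «formal change of the old variables» (`A₀ ↦ θ^* A₀`, again a position since `ord (θ^* A₀) ≥ ord A₀`), besides cleaning,
  the cleaned point blow-up and the cleaned curve blow-ups; every resulting position in the exit class `T` or of smaller rank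
  ⇒ every `y² + A₀` (`ord A₀ > 2`) is won;
* `charTwoInseparableReductionWon_of_insepRankX`: the v21–v24 stub S2iM `stub_charTwoInseparableReductionWon` VERBATIM from
  the existence of such a rank relative to the TERMINAL exit class over every algebraically closed field of characteristic `2`.
-/

set_option linter.dupNamespace false -- mandated namespace of this single-conjunct summit

namespace Summit.ResolutionOfSingularities.ResolutionOfSingularities.Theorems

open Literature.AlgebraicGeometry.Resolution
open Literature.AlgebraicGeometry.Resolution.CobordantGame

namespace InsepDoublePoint

open MvPowerSeries

variable {k : Type} [Field k]

/-- Linear coefficients of a series renamed along `Fin.succAbove (Fin.last 2)`: old slots. -/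
theorem coeff_single_castSucc_rename (g : MvPowerSeries (Fin 2) k) (j : Fin 2) :
    coeff (Finsupp.single (Fin.castSucc j) 1) (rename (Fin.succAboveEmb (Fin.last 2)) g) = coeff (Finsupp.single j 1) g := by
  rw [← TerminalDoublePoint.embDomain_single, coeff_embDomain_rename]

/-- … and the new slot: no `y`. -/
theorem coeff_single_last_rename (g : MvPowerSeries (Fin 2) k) :
    coeff (Finsupp.single (Fin.last 2) 1) (rename (Fin.succAboveEmb (Fin.last 2)) g) = 0 := by
  have h := TschirnhausForm.coeff_emb_add_single_rename (m := 2) (0 : Fin 2 →₀ ℕ) 1 g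
  rwa [Finsupp.embDomain_zero, zero_add, if_neg one_ne_zero] at h

/-- A FORMAL CHANGE OF THE OLD VARIABLES IS A FREE MOVE (every `d`, every field): for `θ : k[[x₀,x₁]] → k[[x₀,x₁]]` with
`θ(0) = 0` and invertible linear part, `y^d + (θ^* A₀)♮` is won iff `y^d + A₀♮` is. -/
theorem won_Xpow_add_xChange_iff (d : ℕ) (θ : Fin 2 → MvPowerSeries (Fin 2) k)
    (hθ0 : ∀ i, constantCoeff (θ i) = 0)
    (hθdet : IsUnit (Matrix.det (Matrix.of fun i j => coeff (Finsupp.single j 1) (θ i))))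
    (A₀ : MvPowerSeries (Fin 2) k) :
    CobordantGame.Won k 3 (X (Fin.last 2) ^ d + rename (Fin.succAboveEmb (Fin.last 2)) (subst θ A₀)) ↔
      CobordantGame.Won k 3 (X (Fin.last 2) ^ d + rename (Fin.succAboveEmb (Fin.last 2)) A₀) := by
  classical
  -- the change `Θ = (θ♮, y)` of all three variables
  set Θ : Fin 3 → MvPowerSeries (Fin 3) k :=
    ![rename (Fin.succAboveEmb (Fin.last 2)) (θ 0), rename (Fin.succAboveEmb (Fin.last 2)) (θ 1), X (Fin.last 2)] with hΘ
  have hΘ0 : ∀ i, constantCoeff (Θ i) = 0 := by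
    intro i
    fin_cases i
    · simp [hΘ, constantCoeff_rename, hθ0]
    · simp [hΘ, constantCoeff_rename, hθ0]
    · simp [hΘ, constantCoeff_X]
  have hΘs : HasSubst Θ := hasSubst_of_constantCoeff_zero hΘ0
  have hcast : (fun i : Fin 2 => Θ ((Fin.succAboveEmb (Fin.last 2)) i)) =
      fun i => rename (Fin.succAboveEmb (Fin.last 2)) (θ i) := by
    funext i
    fin_cases i <;> rfl
  have hsub : subst Θ (X (Fin.last 2) ^ d + rename (Fin.succAboveEmb (Fin.last 2)) A₀) =
      X (Fin.last 2) ^ d + rename (Fin.succAboveEmb (Fin.last 2)) (subst θ A₀) := by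
    rw [subst_add hΘs, subst_pow hΘs, subst_X hΘs, subst_rename_eq _ Θ hΘ0, hcast, ← rename_subst_eq _ θ hθ0]
    rfl
  -- its linear part: block matrix `[[linMat θ, 0], [0, 1]]`
  have hΘdet : IsUnit (FormalCoordChange.linMat Θ).det := by
    have h00 : FormalCoordChange.linMat Θ 0 0 = coeff (Finsupp.single 0 1) (θ 0) := by
      simp only [FormalCoordChange.linMat, Matrix.of_apply, hΘ, Matrix.cons_val_zero]
      exact coeff_single_castSucc_rename (θ 0) 0
    have h01 : FormalCoordChange.linMat Θ 0 1 = coeff (Finsupp.single 1 1) (θ 0) := by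
      simp only [FormalCoordChange.linMat, Matrix.of_apply, hΘ, Matrix.cons_val_zero]
      exact coeff_single_castSucc_rename (θ 0) 1
    have h10 : FormalCoordChange.linMat Θ 1 0 = coeff (Finsupp.single 0 1) (θ 1) := by
      simp only [FormalCoordChange.linMat, Matrix.of_apply, hΘ, Matrix.cons_val_one, Matrix.cons_val_zero]
      exact coeff_single_castSucc_rename (θ 1) 0
    have h11 : FormalCoordChange.linMat Θ 1 1 = coeff (Finsupp.single 1 1) (θ 1) := by
      simp only [FormalCoordChange.linMat, Matrix.of_apply, hΘ, Matrix.cons_val_one, Matrix.cons_val_zero]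
      exact coeff_single_castSucc_rename (θ 1) 1
    have h02 : FormalCoordChange.linMat Θ 0 2 = 0 := by
      simp only [FormalCoordChange.linMat, Matrix.of_apply, hΘ, Matrix.cons_val_zero]
      exact coeff_single_last_rename (θ 0)
    have h12 : FormalCoordChange.linMat Θ 1 2 = 0 := by
      simp only [FormalCoordChange.linMat, Matrix.of_apply, hΘ, Matrix.cons_val_one, Matrix.cons_val_zero]
      exact coeff_single_last_rename (θ 1)
    have h20 : FormalCoordChange.linMat Θ 2 0 = 0 := by
      simp [FormalCoordChange.linMat, hΘ, coeff_index_single_X]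
    have h21 : FormalCoordChange.linMat Θ 2 1 = 0 := by
      simp [FormalCoordChange.linMat, hΘ, coeff_index_single_X]
    have h22 : FormalCoordChange.linMat Θ 2 2 = 1 := by
      simp [FormalCoordChange.linMat, hΘ]
    rw [Matrix.det_fin_three, h00, h01, h02, h10, h11, h12, h20, h21, h22]
    rw [Matrix.det_fin_two, Matrix.of_apply, Matrix.of_apply, Matrix.of_apply, Matrix.of_apply] at hθdet
    convert hθdet using 1
    ring
  rw [← hsub]
  exact won_subst_iff hΘ0 hΘdet _

/-- A position stays a position under a formal change of the old variables: `ord (θ^* A₀) ≥ ord A₀`. -/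
theorem two_lt_order_subst {θ : Fin 2 → MvPowerSeries (Fin 2) k} (hθ0 : ∀ i, constantCoeff (θ i) = 0)
    {A₀ : MvPowerSeries (Fin 2) k} (hA₀ : (2 : ℕ∞) < A₀.order) : (2 : ℕ∞) < (subst θ A₀).order :=
  lt_of_lt_of_le hA₀ (PlaneMonomialPhase.order_le_order_subst θ hθ0 A₀)

end InsepDoublePoint

open InsepDoublePoint TerminalDoublePoint MvPowerSeries in
/-- THE INSEP LIFT WITH FORMAL CHANGES OF THE OLD VARIABLES (characteristic `2`, `k` algebraically closed; one-variable
singular germs won).  Exit class `T`, ordinal rank `κ`; from every position `A₀` (`ord A₀ > 2`) outside `T` the rank player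
names ONE of: a cleaning `A₀ + φ²`; a formal change `θ^* A₀` of `k[[x₀,x₁]]` (`θ(0) = 0`, invertible linear part); the point
blow-up (all cleaned same-class successors); a permissible curve blow-up `V(x_i, y)` (all cleaned successors) — every resulting
position in `T` or of smaller rank.  Then every `y² + A₀` with `ord A₀ > 2` is won. [OURS · L1 W4.3, (u3) interface + (D4)] -/
theorem insepWon_of_rankX (k : Type) [Field k] [CharP k 2] [IsAlgClosed k]
    (hlow : ∀ g : MvPowerSeries (Fin 1) k, CobordantGame.IsSingular k g → CobordantGame.Won k 1 g)
    (T : MvPowerSeries (Fin 2) k → Prop)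
    (hT : ∀ A₀ : MvPowerSeries (Fin 2) k, T A₀ →
      CobordantGame.Won k 3 (X (Fin.last 2) ^ 2 + rename (Fin.succAboveEmb (Fin.last 2)) A₀))
    (κ : MvPowerSeries (Fin 2) k → Ordinal.{0})
    (hstep : ∀ A₀ : MvPowerSeries (Fin 2) k, (2 : ℕ∞) < A₀.order → T A₀ ∨
      (∃ φ : MvPowerSeries (Fin 2) k, constantCoeff φ = 0 ∧ (2 : ℕ∞) < (A₀ + φ ^ 2).order ∧
        (T (A₀ + φ ^ 2) ∨ κ (A₀ + φ ^ 2) < κ A₀)) ∨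
      (∃ θ : Fin 2 → MvPowerSeries (Fin 2) k, (∀ i, constantCoeff (θ i) = 0) ∧
        IsUnit (Matrix.det (Matrix.of fun i j => coeff (Finsupp.single j 1) (θ i))) ∧
        (T (subst θ A₀) ∨ κ (subst θ A₀) < κ A₀)) ∨
      (∀ (c : Fin 2 → k) (i₀ : Fin 2), c i₀ ≠ 0 → ∀ (A' : MvPowerSeries (Fin 2) k) (α β : k),
        subst (fun l : Fin 2 => if l = i₀ then C (c i₀) * X 0 else
          X 0 * (C (c l) + (X 1 : MvPowerSeries (Fin 2) k))) A₀ = X 0 ^ 2 * A' →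
        α ^ 2 = coeff (Finsupp.single 0 2) A' → β ^ 2 = coeff (Finsupp.single 1 2) A' →
        (2 : ℕ∞) < (A' + (C α * X 0 + C β * X 1) ^ 2).order →
        T (A' + (C α * X 0 + C β * X 1) ^ 2) ∨ κ (A' + (C α * X 0 + C β * X 1) ^ 2) < κ A₀) ∨
      (∃ (i : Fin 2) (A₀' : MvPowerSeries (Fin 2) k), A₀ = X i ^ 2 * A₀' ∧ constantCoeff A₀' = 0 ∧
        ∀ c : k, c ≠ 0 → ∀ (A' : MvPowerSeries (Fin 2) k) (α β : k),
        A' = C (c ^ 2) * subst (fun l : Fin 2 => if l = i then C c * X 0 else (X 1 : MvPowerSeries (Fin 2) k)) A₀' →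
        α ^ 2 = coeff (Finsupp.single 0 2) A' → β ^ 2 = coeff (Finsupp.single 1 2) A' →
        (2 : ℕ∞) < (A' + (C α * X 0 + C β * X 1) ^ 2).order →
        T (A' + (C α * X 0 + C β * X 1) ^ 2) ∨ κ (A' + (C α * X 0 + C β * X 1) ^ 2) < κ A₀)) :
    ∀ A₀ : MvPowerSeries (Fin 2) k, (2 : ℕ∞) < A₀.order →
      CobordantGame.Won k 3 (X (Fin.last 2) ^ 2 + rename (Fin.succAboveEmb (Fin.last 2)) A₀) := by
  suffices key : ∀ (o : Ordinal.{0}) (A₀ : MvPowerSeries (Fin 2) k), κ A₀ = o → (2 : ℕ∞) < A₀.order →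
      Won k 3 (X (Fin.last 2) ^ 2 + rename (Fin.succAboveEmb (Fin.last 2)) A₀) from
    fun A₀ h => key _ A₀ rfl h
  intro o
  induction o using WellFoundedLT.induction with
  | ind o ih =>
  intro A₀ ho hA₀
  have hres : ∀ B : MvPowerSeries (Fin 2) k, (2 : ℕ∞) < B.order → (T B ∨ κ B < κ A₀) →
      Won k 3 (X (Fin.last 2) ^ 2 + rename (Fin.succAboveEmb (Fin.last 2)) B) := by
    intro B hB hTB
    rcases hTB with hTB | hlt
    · exact hT B hTB
    · exact ih _ (ho ▸ hlt) B rfl hB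
  rcases hstep A₀ hA₀ with hTA | ⟨φ, hφ, hordφ, hresφ⟩ | ⟨θ, hθ0, hθdet, hresθ⟩ | hpoint | ⟨i, A₀', hdiv, h0, hcurve⟩
  · exact hT A₀ hTA
  · exact (won_dp_add_sq_iff φ hφ A₀).mp (hres _ hordφ hresφ)
  · exact (won_Xpow_add_xChange_iff 2 θ hθ0 hθdet A₀).mp (hres _ (two_lt_order_subst hθ0 hA₀) hresθ)
  · exact won_insep_of_pointStep k hlow A₀ hA₀ fun c i₀ hc A' α β hfac hα hβ hord =>
      hres _ hord (hpoint c i₀ hc A' α β hfac hα hβ hord)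
  · exact won_insep_of_curveStep k hlow i A₀ A₀' hdiv h0 fun c hc A' α β hA' hα hβ hord =>
      hres _ hord (hcurve c hc A' α β hA' hα hβ hord)

open InsepDoublePoint TerminalDoublePoint MvPowerSeries in
/-- S2iM FROM A RANK WITH FORMAL CHANGES (the v21–v24 stub `stub_charTwoInseparableReductionWon` VERBATIM as conclusion): if over
every algebraically closed field of characteristic `2` there is an ordinal rank on `k[[x₀,x₁]]` with the step property of
`insepWon_of_rankX` — cleanings, formal changes of the old variables, cleaned point / curve blow-ups — relative to the
TERMINAL exit class, then every `y² + A₀` with `ord A₀ > 2` is won, given the singular germs in `≤ 2` variables and the terminal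
double points.  [OURS · L1 W4.3; the rank = Hauser–Wagner's intricacy/slope in subordinate coordinates, DECISION (D4)] -/
theorem charTwoInseparableReductionWon_of_insepRankX
    (hrank : ∀ (k : Type) [Field k] [CharP k 2] [IsAlgClosed k], ∃ κ : MvPowerSeries (Fin 2) k → Ordinal.{0},
      ∀ A₀ : MvPowerSeries (Fin 2) k, (2 : ℕ∞) < A₀.order →
      let T : MvPowerSeries (Fin 2) k → Prop := fun B => (2 : ℕ∞) < B.order ∧
        ((∃ (r s : ℕ) (U : MvPowerSeries (Fin 2) k), constantCoeff U ≠ 0 ∧ ¬ (2 ∣ r ∧ 2 ∣ s) ∧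
            B = X (0 : Fin 2) ^ r * X (1 : Fin 2) ^ s * U) ∨
          (∃ (i : Fin 2) (m : ℕ) (g : MvPowerSeries (Fin 2) k), 0 < m ∧ g.order = 1 ∧ B = X i ^ (2 * m) * g))
      T A₀ ∨
      (∃ φ : MvPowerSeries (Fin 2) k, constantCoeff φ = 0 ∧ (2 : ℕ∞) < (A₀ + φ ^ 2).order ∧
        (T (A₀ + φ ^ 2) ∨ κ (A₀ + φ ^ 2) < κ A₀)) ∨
      (∃ θ : Fin 2 → MvPowerSeries (Fin 2) k, (∀ i, constantCoeff (θ i) = 0) ∧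
        IsUnit (Matrix.det (Matrix.of fun i j => coeff (Finsupp.single j 1) (θ i))) ∧
        (T (subst θ A₀) ∨ κ (subst θ A₀) < κ A₀)) ∨
      (∀ (c : Fin 2 → k) (i₀ : Fin 2), c i₀ ≠ 0 → ∀ (A' : MvPowerSeries (Fin 2) k) (α β : k),
        subst (fun l : Fin 2 => if l = i₀ then C (c i₀) * X 0 else
          X 0 * (C (c l) + (X 1 : MvPowerSeries (Fin 2) k))) A₀ = X 0 ^ 2 * A' →
        α ^ 2 = coeff (Finsupp.single 0 2) A' → β ^ 2 = coeff (Finsupp.single 1 2) A' →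
        (2 : ℕ∞) < (A' + (C α * X 0 + C β * X 1) ^ 2).order →
        T (A' + (C α * X 0 + C β * X 1) ^ 2) ∨ κ (A' + (C α * X 0 + C β * X 1) ^ 2) < κ A₀) ∨
      (∃ (i : Fin 2) (A₀' : MvPowerSeries (Fin 2) k), A₀ = X i ^ 2 * A₀' ∧ constantCoeff A₀' = 0 ∧
        ∀ c : k, c ≠ 0 → ∀ (A' : MvPowerSeries (Fin 2) k) (α β : k),
        A' = C (c ^ 2) * subst (fun l : Fin 2 => if l = i then C c * X 0 else (X 1 : MvPowerSeries (Fin 2) k)) A₀' →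
        α ^ 2 = coeff (Finsupp.single 0 2) A' → β ^ 2 = coeff (Finsupp.single 1 2) A' →
        (2 : ℕ∞) < (A' + (C α * X 0 + C β * X 1) ^ 2).order →
        T (A' + (C α * X 0 + C β * X 1) ^ 2) ∨ κ (A' + (C α * X 0 + C β * X 1) ^ 2) < κ A₀)) :
    ∀ (k : Type) [Field k] [CharP k 2] [IsAlgClosed k],
      (∀ m : ℕ, m < 3 → ∀ g : MvPowerSeries (Fin m) k,
        CobordantGame.IsSingular k g → CobordantGame.Won k m g) →
      (∀ (A₀ : MvPowerSeries (Fin 2) k), (2 : ℕ∞) < A₀.order →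
        ((∃ (r s : ℕ) (U : MvPowerSeries (Fin 2) k), MvPowerSeries.constantCoeff U ≠ 0 ∧ ¬ (2 ∣ r ∧ 2 ∣ s) ∧
            A₀ = MvPowerSeries.X (0 : Fin 2) ^ r * MvPowerSeries.X (1 : Fin 2) ^ s * U) ∨
          (∃ (i : Fin 2) (m : ℕ) (g : MvPowerSeries (Fin 2) k), 0 < m ∧ g.order = 1 ∧
            A₀ = MvPowerSeries.X i ^ (2 * m) * g)) →
        CobordantGame.Won k 3 (MvPowerSeries.X (Fin.last 2) ^ 2 +
          MvPowerSeries.rename (Fin.succAboveEmb (Fin.last 2)) A₀)) →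
      ∀ (A₀ : MvPowerSeries (Fin 2) k), (2 : ℕ∞) < A₀.order →
        CobordantGame.Won k 3 (MvPowerSeries.X (Fin.last 2) ^ 2 +
          MvPowerSeries.rename (Fin.succAboveEmb (Fin.last 2)) A₀) := by
  intro k _ _ _ hlow hterm A₀ hA₀
  obtain ⟨κ, hκ⟩ := hrank k
  exact insepWon_of_rankX k (hlow 1 (by norm_num)) _ (fun B hB => hterm B hB.1 hB.2) κ hκ A₀ hA₀

end Summit.ResolutionOfSingularities.ResolutionOfSingularities.Theorems
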